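import Mathlib
import Literature.NumberTheory.Irrationality.Lai2025TwoAdic.GeneralRationalFunctionB
import Literature.NumberTheory.Irrationality.Lai2025TwoAdic.LinearFormsT
import Literature.Algebra.Module.LocalGlobalLattice
import HarnessLib

/-!
# Lai 2025 (IJNT, `2`-adic zeta values), §3–§5 for GENERAL `s`: the linear forms
# `T_n = ∫_{ℤ₂} B_n^{(s)}(t+¼)dt = σ_{n,0} + Σ_{i=2}^{s+2} σ_{n,i}·ζ₂(i+s+1,¼)` (Lemma 3.3),
# `d_n^{s+2−i}σ_{n,i} ∈ ℤ`, `d_n^{2s+3}σ_{n,0} ∈ ℤ` (Lemmas 4.5–4.6) and `|σ_{n,i}| ≤ n^{O(s)}·2^{(3s+6)n}` (Lemma 5.2) — PROVED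

Topic `Literature/NumberTheory/Irrationality/Lai2025TwoAdic`.  Source: L. Lai, *On the irrationality of certain
`2`-adic zeta values*, Int. J. Number Theory (2025) = arXiv:2304.00816 [Lai2025TwoAdicZeta] (held text
`paper:arxiv-2304.00816`, chunks p0007–p0010 = §§3–5, read on the page).  PROOF FILE (definitions with bodies +
theorems; no named fact, net debt 0); file 2 of the discharge of the tree's named fact
`PAdicZetaValues.lai2025TwoAdic_theorem13` ([Lai2025TwoAdicZeta, Thm 1.3]) for GENERAL `s`.  Companion of
`GeneralRationalFunctionB.lean` (`Bs s n`, `coeffBs s n i k = b_{n,i,k}`, `Bs_eq_sum_coeffBs`, Lemma 4.2, `abs_coeffBs_le`);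
the case `s = 0` is the tree's `LinearFormsT.lean`, whose Lemma 2.2/2.6 tool `tendsto_volkenbornSum_quarter_shift_zpow_neg`
and prime-by-prime lemmas (`pow_log_succ_dvd_of_one_lt_padicNorm`, `not_dvd_both`) are reused.

## Source, as printed

* **Definition 3.2.** «`T_n := ∫_{ℤ₂} B_n^{(s)}(t + ¼) dt ∈ ℚ₂`.»
* **Lemma 3.3.** «`T_n = σ_{n,0} + Σ_{i=2}^{s+2} σ_{n,i} ζ₂(i+s+1, ¼)` [(eqn_T_sigma)], where
  `σ_{n,0} = (−1)^{s+1} Σ_{i=1}^{s+2}Σ_{k=1}^{n}Σ_{ℓ=0}^{k−1} (i)_{s+1} b_{n,i,k}/(ℓ+¼)^{i+s+1} ∈ ℚ`,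
  `σ_{n,i} = (−1)^s (i)_{s+1} 4^{i+s} Σ_{k=0}^{n} b_{n,i,k} ∈ ℚ (1 ≤ i ≤ s+2)`.  *Proof.* By (def_a), we have
  `A_n^{(s)}(t+¼) = (−1)^s Σ_{i=1}^{2s+4}Σ_{k=0}^{n} (i)_s a_{n,i,k}/(t+k+¼)^{i+s}`.  Therefore … [Lemma 2.2, the translation
  formula] … [Lemma 2.6: `∫_{ℤ₂} dt/(t+¼)^{i+s} = (i+s)4^{i+s}ζ₂(i+s+1,¼)`] … Here when `k = 0`, the sum `Σ_{ℓ=0}^{k−1}` is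
  understood as `0`. … The proof of (eqn_T_sigma) is similar and simpler: we have `σ_{n,1} = 0` since `deg B_n(t) ≤ −2`, and we
  do not need to consider the parity.»
* **Lemma 4.5.** «`d_n^{s+2−i}σ_{n,i} ∈ ℤ. (1 ≤ i ≤ s+2)` [(sigma_i_ari)] … follows from (def_sigma_i) and (ari_b).»
* **Lemma 4.6.** «`d_n^{2s+3}σ_{n,0} ∈ ℤ` [(sigma_0_ari)].  *Proof.* [for `ρ_{n,0}`: if some term were not integral, the root
  `t = −k₀+ℓ₀+¼` of `A_n^{(s+1)}` gives `k₁ ≠ k₀` and a prime `q` with] `v_q(ℓ₀ + ¼) > v_q(d_n)`, `v_q(−k₀+ℓ₀+k₁+¼) > v_q(d_n)`,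
  then `v_q(−k₀+k₁) > v_q(d_n)`.  But this contradicts `0 < |−k₀+k₁| ≤ n`. … The proof of (sigma_0_ari) is similar.  The key
  point is that `B_n^{(s+1)}(t)` has roots `−1+¼, −2+¼, …, −n+¼`.»
* **Lemma 5.2.** «`max_{0≤i≤s+2} |σ_{n,i}| ≤ 2^{(3s+6+o(1))n}` [(sigma_est)].»

## What is formalised (all PROVED)

* `iteratedDeriv_inv_pow_add_const`, `iteratedDeriv_Bs` — the derivatives of `B_n` through (def_b):
  `B_n^{(r)}(x) = (−1)^r Σ_k Σ_i (i)_r b_{n,i,k} (x+k)^{−(i+r)}` off the poles (`(i)_r = i.ascFactorial r`);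
  `iteratedDeriv_Bs_quarter_eq_zero` — `B_n^{(s+1)}(¼ − m) = 0` for `1 ≤ m ≤ n` (the zero of order `s+2`; tree
  `divDeriv_sub_pow_mul`).
* `DBsq s n` (over `ℚ`) / `DBs s n : ℤ₂ → ℚ₂` — the integrand `B_n^{(s)}(t+¼)` of Definition 3.2 written in the closed form
  `(−1)^sΣ_kΣ_i (i)_s b_{n,i,k}(t+k+¼)^{−(i+s)}`, with the FIDELITY lemma `DBsq_eq_iteratedDeriv`/`DBsq_natCast`:
  `DBsq s n x = (d/dx)^s[B_n(x+¼)]` off the shifted poles (every natural `x`), and `DBs_natCast`;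
  **Definition 3.2** `Ts s n := ∫_{ℤ₂} DBs s n`.
* `sigmaI s n i` (`σ_{n,i}`), `XtermS`, `sigmaZero s n` (`σ_{n,0}`); `sigmaI_one` (`σ_{n,1} = 0`).
* **Lemma 3.3** `tendsto_volkenbornSum_DBs`, `Ts_eq`:
  `T_n = σ_{n,0} + Σ_{i=2}^{s+2} σ_{n,i}·ζ₂(i+s+1,¼)` with `ζ₂(j,¼)` the TREE's `padicHurwitzZeta 2 j 4⁻¹`.
* **Lemma 4.5** `exists_int_lcm_pow_mul_sigmaI` (`d_n^{s+2−i}σ_{n,i} ∈ ℤ`; also `d_n^{2s+3}σ_{n,i} ∈ ℤ`).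
* The root relation `sum_XtermS_root_eq_zero` (`B_n^{(s+1)}(¼ − m) = 0` read through (def_b)) and **Lemma 4.6**
  `exists_int_lcm_pow_mul_sigmaZero` (`d_n^{2s+3}σ_{n,0} ∈ ℤ`), proved prime by prime exactly as printed (`padicNorm`;
  a rational which is `q`-integral at every prime is an integer, tree `Rat.exists_int_eq_of_forall_padicNorm_le_one`).
* **Lemma 5.2**, explicit form: `abs_sigmaI_le`, `abs_sigmaZero_le` — `|σ_{n,i}|, |σ_{n,0}| ≤ K(s)·(n+1)^{s+4}·2^{(3s+6)n}` with
  `K(s) = Ksig s = (s+3)(2s+3)^{s+1}4^{2s+3}(5(s+2))^{s+1}` (from `abs_coeffBs_le`; the printed `o(1)` made explicit as a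
  polynomial factor).

Cell zeta5-irr / pub-zeta5 (HONEST FRAMING: systematic search; no irrationality claim unless kernel-certified):
`2`-adic linear forms in `1, ζ₂(j,¼)`; nothing here bears on `ζ(5) ∈ ℝ`.
-/

noncomputable section

namespace Literature.NumberTheory.Irrationality.Lai2025TwoAdic

section GeneralLinearForms

open Finset Filter Topology
open Literature.Analysis.Calculus
open Literature.NumberTheory.LocalFields
open Literature.NumberTheory.Transcendental
open Literature.NumberTheory.Irrationality.PAdicZetaValues
open scoped Nat

/-! ## §1. The derivatives of `B_n` through (def_b) -/

/-- `∏_{u<r}(−i − u) = (−1)^r (i)_r` (`(i)_r = i(i+1)⋯(i+r−1)`). [folklore] -/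
private theorem prod_neg_sub_eq (i r : ℕ) :
    ∏ u ∈ range r, ((((-(i : ℤ)) : ℤ) : ℚ) - (u : ℚ)) = (-1) ^ r * (i.ascFactorial r : ℚ) := by
  rw [Nat.ascFactorial_eq_prod_range, Nat.cast_prod, ← card_range r, ← prod_const, card_range,
    ← prod_mul_distrib]
  exact prod_congr rfl fun u _ => by push_cast; ring

/-- **The `r`-th derivative of a pole term**: `((t+c)^{−i})^{(r)}(x) = (−1)^r (i)_r (x+c)^{−(i+r)}`
(«`A_n^{(s)}(t+¼) = (−1)^s Σ (i)_s a_{n,i,k}/(t+k+¼)^{i+s}`»). [cite: Lai2025TwoAdicZeta, Lemma 3.3 (proof, first display)] -/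
theorem iteratedDeriv_inv_pow_add_const (i r : ℕ) (c x : ℚ) :
    iteratedDeriv r (fun t : ℚ => ((t + c) ^ i)⁻¹) x =
      (-1) ^ r * (i.ascFactorial r : ℚ) * ((x + c) ^ (i + r))⁻¹ := by
  have hf : (fun t : ℚ => ((t + c) ^ i)⁻¹) = fun t => (t + c) ^ (-(i : ℤ)) := by
    funext t; rw [zpow_neg, zpow_natCast]
  rw [hf, iteratedDeriv_comp_add_const r (fun t : ℚ => t ^ (-(i : ℤ))) c]
  simp only
  rw [iteratedDeriv_eq_iterate, iter_deriv_zpow, prod_neg_sub_eq,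
    show (-(i : ℤ) - (r : ℕ) : ℤ) = -((i + r : ℕ) : ℤ) by push_cast; ring, zpow_neg, zpow_natCast]

/-- A term `b·(t+k)^{−i}` of (def_b) is smooth off `−k`. [folklore] -/
private theorem contDiffAt_const_mul_inv_pow {x : ℚ} (b : ℚ) (k i : ℕ) (hxk : x + k ≠ 0) {N : WithTop ℕ∞} :
    ContDiffAt ℚ N (fun t : ℚ => b * ((t + k) ^ i)⁻¹) x :=
  contDiffAt_const.mul (((contDiffAt_id.add contDiffAt_const).pow i).inv (pow_ne_zero _ hxk))

/-- **The derivatives of `B_n` through (def_b)**: off the poles,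
`B_n^{(r)}(x) = (−1)^r Σ_{k=0}^{n} Σ_{i=1}^{s+2} (i)_r b_{n,i,k} (x+k)^{−(i+r)}` (termwise differentiation of (def_b)).
[cite: Lai2025TwoAdicZeta, Lemma 3.3 (proof: B_n^{(s)}(t+¼) from (def_b)) and Lemma 4.6 (proof: B_n^{(s+1)})] -/
theorem iteratedDeriv_Bs (s n r : ℕ) {x : ℚ} (hx : ∀ j ∈ range (n + 1), x + j ≠ 0) :
    iteratedDeriv r (Bs s n) x = (-1) ^ r * ∑ k ∈ range (n + 1), ∑ i ∈ Icc 1 (s + 2),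
      (i.ascFactorial r : ℚ) * coeffBs s n i k * ((x + k) ^ (i + r))⁻¹ := by
  have heq : (fun t => ∑ k ∈ range (n + 1), ∑ i ∈ Icc 1 (s + 2), coeffBs s n i k * ((t + k) ^ i)⁻¹)
      =ᶠ[𝓝 x] Bs s n := by
    filter_upwards [LaiSprangZudilin2026.eventually_nhds_forall_add_ne_zero (range (n + 1)) hx] with t ht
    rw [Bs_eq_sum_coeffBs s n ht]
  rw [← heq.iteratedDeriv_eq r]
  have hterm : ∀ k ∈ range (n + 1), ∀ i ∈ Icc 1 (s + 2),
      ContDiffAt ℚ r (fun t : ℚ => coeffBs s n i k * ((t + k) ^ i)⁻¹) x :=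
    fun k hk i _ => contDiffAt_const_mul_inv_pow _ k i (hx k hk)
  rw [iteratedDeriv_fun_sum fun k hk => ContDiffAt.sum fun i hi => hterm k hk i hi, mul_sum]
  refine sum_congr rfl fun k hk => ?_
  rw [iteratedDeriv_fun_sum fun i hi => hterm k hk i hi, mul_sum]
  refine sum_congr rfl fun i _ => ?_
  have hf : ContDiffAt ℚ r (fun t : ℚ => ((t + k) ^ i)⁻¹) x :=
    ((contDiffAt_id.add contDiffAt_const).pow i).inv (pow_ne_zero _ (hx k hk))
  rw [iteratedDeriv_const_mul _ hf, iteratedDeriv_inv_pow_add_const]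
  ring

/-- **`B_n^{(s+1)}` vanishes at `¼ − m`** (`1 ≤ m ≤ n`): `B_n` has the factor `(t + ¾ + (m−1))^{s+2}`, a zero of order
`s+2` («The key point is that `B_n^{(s+1)}(t)` has roots `−1+¼, −2+¼, …, −n+¼`»).
[cite: Lai2025TwoAdicZeta, Lemma 4.6 (proof, last sentence)] -/
theorem iteratedDeriv_Bs_quarter_eq_zero (s n : ℕ) {m : ℕ} (hm1 : 1 ≤ m) (hmn : m ≤ n) :
    iteratedDeriv (s + 1) (Bs s n) ((1 : ℚ) / 4 - m) = 0 := by
  classical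
  set t₀ : ℚ := (1 : ℚ) / 4 - m with ht₀
  have hj0 : m - 1 ∈ range n := mem_range.2 (by omega)
  -- the smooth cofactor
  set H : ℚ → ℚ := fun t => (2 : ℚ) ^ ((3 * s + 6) * n) * (∏ j ∈ (range n).erase (m - 1), (t + 3 / 4 + j)) ^ (s + 2) /
    (∏ j ∈ range (n + 1), (t + j)) ^ (s + 2) with hH
  have hfac : ∀ t : ℚ, t + 3 / 4 + ((m - 1 : ℕ) : ℚ) = t - t₀ := by
    intro t
    rw [Nat.cast_sub hm1, ht₀]; push_cast; ring
  have hform : Bs s n = fun t => (t - t₀) ^ (s + 2) * H t := by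
    funext t
    rw [Bs, hH, ← mul_prod_erase (range n) (fun j => t + 3 / 4 + (j : ℚ)) hj0, hfac t, mul_pow]
    ring
  have hden : ∏ j ∈ range (n + 1), (t₀ + j) ≠ 0 := by
    refine prod_ne_zero_iff.2 fun j _ => ?_
    rw [ht₀]
    intro h
    have h4 : (4 * (j : ℤ) - 4 * m + 1 : ℤ) = 0 := by
      have : (4 * (j : ℚ) - 4 * m + 1) = 0 := by linarith
      exact_mod_cast this
    omega
  have hHs : ContDiffAt ℚ ((s + 1 : ℕ) : WithTop ℕ∞) H t₀ := by
    rw [hH]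
    refine ContDiffAt.div (by fun_prop) (by fun_prop) (pow_ne_zero _ hden)
  have hD := divDeriv_sub_pow_mul hHs (s + 2)
  rw [if_pos (by omega : s + 1 < s + 2)] at hD
  rw [hform, iteratedDeriv_eq_factorial_mul_divDeriv, hD, mul_zero]

/-! ## §2. Definition 3.2: the integrand `B_n^{(s)}(t+¼)` and `T_n := ∫_{ℤ₂} B_n^{(s)}(t+¼) dt` -/

/-- The `s`-th derivative `B_n^{(s)}(x + ¼)` in CLOSED FORM through (def_b):
`(−1)^s Σ_{k≤n} Σ_{i=1}^{s+2} (i)_s b_{n,i,k} (x+k+¼)^{−(i+s)}` (over `ℚ`). [cite: Lai2025TwoAdicZeta, Lemma 3.3 (proof, first display, B-version)] -/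
def DBsq (s n : ℕ) (x : ℚ) : ℚ :=
  (-1) ^ s * ∑ k ∈ range (n + 1), ∑ i ∈ Icc 1 (s + 2),
    (i.ascFactorial s : ℚ) * coeffBs s n i k * ((x + k + 1 / 4) ^ (i + s))⁻¹

/-- **FIDELITY of the closed form**: `DBsq s n x = (d/dx)^s [B_n(x + ¼)]` at every `x` off the shifted poles (in
particular at every natural number). [cite: Lai2025TwoAdicZeta, Definition 3.2 (T_n := ∫ B_n^{(s)}(t+¼)dt) with Lemma 3.3 (proof)] -/
theorem DBsq_eq_iteratedDeriv (s n : ℕ) {x : ℚ} (hx : ∀ j ∈ range (n + 1), x + 1 / 4 + j ≠ 0) :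
    DBsq s n x = iteratedDeriv s (fun y => Bs s n (y + 1 / 4)) x := by
  rw [iteratedDeriv_comp_add_const s (Bs s n) (1 / 4)]
  simp only
  rw [iteratedDeriv_Bs s n s hx, DBsq]
  congr 1
  refine sum_congr rfl fun k _ => sum_congr rfl fun i _ => ?_
  ring_nf

/-- `m + ¼` is never a shifted pole. [cite: Lai2025TwoAdicZeta, §2.3 (|¼|₂ = 4: no zero of t + ¼ on ℤ₂)] -/
theorem natCast_add_quarter_add_ne_zero' (n m : ℕ) : ∀ j ∈ range (n + 1), (m : ℚ) + 1 / 4 + j ≠ 0 :=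
  fun j _ => by positivity

/-- The natural-number instance of the fidelity lemma: `DBsq s n m = (B_n(·+¼))^{(s)}(m)`.
[cite: Lai2025TwoAdicZeta, Definition 3.2] -/
theorem DBsq_natCast (s n m : ℕ) : DBsq s n m = iteratedDeriv s (fun y => Bs s n (y + 1 / 4)) m :=
  DBsq_eq_iteratedDeriv s n (natCast_add_quarter_add_ne_zero' n m)

/-- The `2`-adic integrand `B_n^{(s)}(t+¼)` of Definition 3.2 (`t ∈ ℤ₂`), written through (def_b):
`(−1)^s Σ_{k ≤ n}Σ_{i=1}^{s+2} (i)_s b_{n,i,k}(t+k+¼)^{−(i+s)}`. [cite: Lai2025TwoAdicZeta, Definition 3.2 (T_n) with Lemma 3.3 (proof, first display)] -/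
def DBs (s n : ℕ) (t : ℤ_[2]) : ℚ_[2] :=
  (-1) ^ s * ∑ k ∈ range (n + 1), ∑ i ∈ Icc 1 (s + 2),
    ((((i.ascFactorial s : ℚ) * coeffBs s n i k : ℚ)) : ℚ_[2]) * ((t : ℚ_[2]) + k + 1 / 4) ^ (-((i + s : ℕ) : ℤ))

/-- At natural numbers the `2`-adic integrand is the rational number `DBsq s n m`. [cite: Lai2025TwoAdicZeta, Definition 3.2] -/
theorem DBs_natCast (s n m : ℕ) : DBs s n (m : ℤ_[2]) = ((DBsq s n m : ℚ) : ℚ_[2]) := by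
  have e : ∀ (t : ℚ_[2]) (a : ℕ), t ^ (-(a : ℤ)) = (t ^ a)⁻¹ := fun t a => by rw [zpow_neg, zpow_natCast]
  simp only [DBs, DBsq, e]
  push_cast
  rfl

/-- **Definition 3.2** (general `s`): `T_n := ∫_{ℤ₂} B_n^{(s)}(t+¼) dt` (tree `volkenbornIntegral`; the Riemann sums
converge, `tendsto_volkenbornSum_DBs`). [cite: Lai2025TwoAdicZeta, Definition 3.2 (T_n)] -/
def Ts (s n : ℕ) : ℚ_[2] := volkenbornIntegral 2 (DBs s n)

/-! ## §3. The coefficients `σ_{n,i}`, `σ_{n,0}` of Lemma 3.3 -/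

/-- **`σ_{n,i}`**: `σ_{n,i} = (−1)^s (i)_{s+1} 4^{i+s} Σ_{k=0}^{n} b_{n,i,k}` (`1 ≤ i ≤ s+2`). [cite: Lai2025TwoAdicZeta, Lemma 3.3 (σ_{n,i})] -/
def sigmaI (s n i : ℕ) : ℚ :=
  (-1) ^ s * (i.ascFactorial (s + 1) : ℚ) * 4 ^ (i + s) * ∑ k ∈ range (n + 1), coeffBs s n i k

/-- The inner sum `X_{n,k}(y) := Σ_{i=1}^{s+2} (i)_{s+1}·b_{n,i,k}·y^{−(i+s+1)}` (so that
`σ_{n,0} = (−1)^{s+1}Σ_{k}Σ_{ℓ<k} X_{n,k}(ℓ+¼)` and `B_n^{(s+1)}(t) = (−1)^{s+1}Σ_k X_{n,k}(t+k)`).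
[cite: Lai2025TwoAdicZeta, Lemma 3.3 (def. of σ_{n,0}) and Lemma 4.6 (proof)] -/
def XtermS (s n k : ℕ) (y : ℚ) : ℚ :=
  ∑ i ∈ Icc 1 (s + 2), (i.ascFactorial (s + 1) : ℚ) * coeffBs s n i k * (y ^ (i + s + 1))⁻¹

/-- **`σ_{n,0}`**: `σ_{n,0} = (−1)^{s+1} Σ_{i=1}^{s+2}Σ_{k=1}^{n}Σ_{ℓ=0}^{k−1} (i)_{s+1}b_{n,i,k}/(ℓ+¼)^{i+s+1}` (the `k = 0`
term is an empty sum). [cite: Lai2025TwoAdicZeta, Lemma 3.3 (σ_{n,0})] -/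
def sigmaZero (s n : ℕ) : ℚ :=
  (-1) ^ (s + 1) * ∑ k ∈ range (n + 1), ∑ ℓ ∈ range k, XtermS s n k ((ℓ : ℚ) + 1 / 4)

/-- **`σ_{n,1} = 0`.** [cite: Lai2025TwoAdicZeta, Lemma 3.3 (proof: "we have σ_{n,1} = 0 since deg B_n(t) ≤ −2")] -/
theorem sigmaI_one (s n : ℕ) : sigmaI s n 1 = 0 := by
  rw [sigmaI, sum_coeffBs_one_eq_zero, mul_zero]

/-- `(i)_s · (i+s) = (i)_{s+1}`. [folklore] -/
private theorem ascFactorial_mul_add {R : Type*} [CommRing R] (i s : ℕ) :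
    (i.ascFactorial s : R) * ((i : R) + s) = (i.ascFactorial (s + 1) : R) := by
  rw [Nat.ascFactorial_succ]; push_cast; ring

/-! ## §4. Lemma 3.3: `T_n = σ_{n,0} + Σ_{i=2}^{s+2} σ_{n,i}·ζ₂(i+s+1, ¼)` -/

/-- The Riemann sums of `DBs s n` as the combination of those of `(t+k+¼)^{−(i+s)}`.
[cite: Lai2025TwoAdicZeta, Lemma 3.3 (proof, second display)] -/
theorem volkenbornSum_DBs (s n N : ℕ) : volkenbornSum 2 (DBs s n) N =
    (-1) ^ s * ∑ k ∈ range (n + 1), ∑ i ∈ Icc 1 (s + 2),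
      ((((i.ascFactorial s : ℚ) * coeffBs s n i k : ℚ)) : ℚ_[2]) *
        volkenbornSum 2 (fun t : ℤ_[2] => ((t : ℚ_[2]) + k + 1 / 4) ^ (-((i + s : ℕ) : ℤ))) N := by
  set f : ℕ → ℕ → ℤ_[2] → ℚ_[2] := fun i k t => ((t : ℚ_[2]) + k + 1 / 4) ^ (-((i + s : ℕ) : ℤ)) with hf
  set G : ℕ → ℤ_[2] → ℚ_[2] := fun k t => ∑ i ∈ Icc 1 (s + 2),
    (fun (i : ℕ) (t : ℤ_[2]) => ((((i.ascFactorial s : ℚ) * coeffBs s n i k : ℚ)) : ℚ_[2]) • f i k t) i t with hG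
  have hD : DBs s n = fun t => ((-1 : ℚ_[2]) ^ s) • ∑ k ∈ range (n + 1), G k t := by
    funext t
    simp only [DBs, hG, hf, smul_eq_mul]
  rw [hD, volkenbornSum_smul, volkenbornSum_finset_sum, smul_eq_mul]
  congr 1
  refine sum_congr rfl fun k _ => ?_
  rw [hG, volkenbornSum_finset_sum]
  refine sum_congr rfl fun i _ => ?_
  rw [volkenbornSum_smul, smul_eq_mul]

/-- **Lemma 3.3 (the limit)**: the Riemann sums of `B_n^{(s)}(t+¼)` converge `2`-adically to
`σ_{n,0} + Σ_{i=2}^{s+2} σ_{n,i}·ζ₂(i+s+1,¼)` (termwise: Lemma 2.2 then Lemma 2.6,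
`∫(t+k+¼)^{−(i+s)} = (i+s)4^{i+s}ζ₂(i+s+1,¼) − (i+s)Σ_{ℓ<k}(ℓ+¼)^{−(i+s+1)}`; the term `i = 1` carries `σ_{n,1} = 0`).
[cite: Lai2025TwoAdicZeta, Lemma 3.3 (eqn_T_sigma) and its proof] -/
theorem tendsto_volkenbornSum_DBs (s n : ℕ) :
    Tendsto (volkenbornSum 2 (DBs s n)) atTop
      (𝓝 (((sigmaZero s n : ℚ) : ℚ_[2]) +
        ∑ i ∈ Icc 2 (s + 2), ((sigmaI s n i : ℚ) : ℚ_[2]) * padicHurwitzZeta 2 (i + s + 1) (4 : ℚ_[2])⁻¹)) := by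
  -- termwise limits: `A i` (the `ζ₂` part) and `Bsh i k` (the shift correction)
  set A : ℕ → ℚ_[2] := fun i => ((i : ℚ_[2]) + s) * 4 ^ (i + s) * padicHurwitzZeta 2 (i + s + 1) (4 : ℚ_[2])⁻¹
    with hA
  set Bsh : ℕ → ℕ → ℚ_[2] := fun i k => ∑ ℓ ∈ range k, -((i : ℚ_[2]) + s) * (((ℓ : ℚ_[2]) + 1 / 4) ^ (i + s + 1))⁻¹
    with hBsh
  have hterm : ∀ k : ℕ, ∀ i ∈ Icc 1 (s + 2),
      Tendsto (volkenbornSum 2 (fun t : ℤ_[2] => ((t : ℚ_[2]) + k + 1 / 4) ^ (-((i + s : ℕ) : ℤ)))) atTop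
        (𝓝 (A i + Bsh i k)) := by
    intro k i hi
    obtain ⟨i', rfl⟩ : ∃ i', i = i' + 1 := ⟨i - 1, by have := (mem_Icc.1 hi).1; omega⟩
    have h := tendsto_volkenbornSum_quarter_shift_zpow_neg (i' + s) k
    have e1 : (-(((i' + 1 + s : ℕ)) : ℤ)) = -(((i' + s : ℕ) : ℤ) + 1) := by push_cast; ring
    have hval : ((((i' + s : ℕ)) : ℚ_[2]) + 1) * 4 ^ (i' + s + 1) * padicHurwitzZeta 2 (i' + s + 2) (4 : ℚ_[2])⁻¹ +
        ∑ ℓ ∈ range k, -((((i' + s : ℕ)) : ℚ_[2]) + 1) * (((ℓ : ℚ_[2]) + 1 / 4) ^ (i' + s + 2))⁻¹ =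
          A (i' + 1) + Bsh (i' + 1) k := by
      simp only [hA, hBsh, show i' + 1 + s = i' + s + 1 by ring, show i' + s + 1 + 1 = i' + s + 2 by ring]
      push_cast
      ring_nf
    rw [← hval]
    simp_rw [e1]
    exact h
  have hlim : Tendsto (volkenbornSum 2 (DBs s n)) atTop (𝓝 ((-1) ^ s * ∑ k ∈ range (n + 1), ∑ i ∈ Icc 1 (s + 2),
      ((((i.ascFactorial s : ℚ) * coeffBs s n i k : ℚ)) : ℚ_[2]) * (A i + Bsh i k))) := by
    have h := (tendsto_finsetSum (range (n + 1)) fun k (_ : k ∈ range (n + 1)) =>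
      tendsto_finsetSum (Icc 1 (s + 2)) fun i (hi : i ∈ Icc 1 (s + 2)) =>
        (hterm k i hi).const_mul ((((i.ascFactorial s : ℚ) * coeffBs s n i k : ℚ)) : ℚ_[2])).const_mul
          ((-1 : ℚ_[2]) ^ s)
    refine h.congr fun N => ?_
    rw [volkenbornSum_DBs]
  -- evaluate the limit: the shift corrections give `σ_{n,0}`
  have hBsum : (-1) ^ s * ∑ k ∈ range (n + 1), ∑ i ∈ Icc 1 (s + 2),
      ((((i.ascFactorial s : ℚ) * coeffBs s n i k : ℚ)) : ℚ_[2]) * Bsh i k = ((sigmaZero s n : ℚ) : ℚ_[2]) := by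
    rw [sigmaZero]
    push_cast
    rw [pow_succ, mul_assoc, neg_one_mul, ← sum_neg_distrib]
    congr 1
    refine sum_congr rfl fun k _ => ?_
    simp only [hBsh, mul_sum]
    rw [Finset.sum_comm, ← sum_neg_distrib]
    refine sum_congr rfl fun ℓ _ => ?_
    rw [XtermS]
    push_cast
    rw [← sum_neg_distrib]
    refine sum_congr rfl fun i _ => ?_
    rw [← ascFactorial_mul_add (R := ℚ_[2])]
    ring
  -- and the `ζ₂` parts give `Σ_i σ_{n,i} ζ₂(i+s+1,¼)`, the term `i = 1` vanishing
  have hAsum : (-1) ^ s * ∑ k ∈ range (n + 1), ∑ i ∈ Icc 1 (s + 2),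
      ((((i.ascFactorial s : ℚ) * coeffBs s n i k : ℚ)) : ℚ_[2]) * A i =
      ∑ i ∈ Icc 2 (s + 2), ((sigmaI s n i : ℚ) : ℚ_[2]) * padicHurwitzZeta 2 (i + s + 1) (4 : ℚ_[2])⁻¹ := by
    rw [Finset.sum_comm, mul_sum]
    have hi : ∀ i ∈ Icc 1 (s + 2), (-1) ^ s * ∑ k ∈ range (n + 1),
        ((((i.ascFactorial s : ℚ) * coeffBs s n i k : ℚ)) : ℚ_[2]) * A i =
        ((sigmaI s n i : ℚ) : ℚ_[2]) * padicHurwitzZeta 2 (i + s + 1) (4 : ℚ_[2])⁻¹ := by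
      intro i _
      rw [sigmaI]
      push_cast
      rw [← ascFactorial_mul_add (R := ℚ_[2])]
      simp only [hA, mul_sum, sum_mul]
      exact sum_congr rfl fun k _ => by ring
    rw [sum_congr rfl hi, ← insert_Icc_add_one_left_eq_Icc (by omega : 1 ≤ s + 2), sum_insert (by simp),
      sigmaI_one]
    push_cast
    rw [zero_mul, zero_add]
  have hval : (-1) ^ s * ∑ k ∈ range (n + 1), ∑ i ∈ Icc 1 (s + 2),
      ((((i.ascFactorial s : ℚ) * coeffBs s n i k : ℚ)) : ℚ_[2]) * (A i + Bsh i k) =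
      ((sigmaZero s n : ℚ) : ℚ_[2]) +
        ∑ i ∈ Icc 2 (s + 2), ((sigmaI s n i : ℚ) : ℚ_[2]) * padicHurwitzZeta 2 (i + s + 1) (4 : ℚ_[2])⁻¹ := by
    rw [← hAsum, ← hBsum, add_comm, ← mul_add, ← sum_add_distrib]
    congr 1
    refine sum_congr rfl fun k _ => ?_
    rw [← sum_add_distrib]
    exact sum_congr rfl fun i _ => by ring
  rw [← hval]
  exact hlim

/-- **Lemma 3.3** (general `s`): `T_n = σ_{n,0} + Σ_{i=2}^{s+2} σ_{n,i}·ζ₂(i+s+1, ¼)`, with `ζ₂(j,¼)` the tree's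
`padicHurwitzZeta 2 j 4⁻¹`. [cite: Lai2025TwoAdicZeta, Lemma 3.3 (eqn_T_sigma)] -/
theorem Ts_eq (s n : ℕ) :
    Ts s n = ((sigmaZero s n : ℚ) : ℚ_[2]) +
      ∑ i ∈ Icc 2 (s + 2), ((sigmaI s n i : ℚ) : ℚ_[2]) * padicHurwitzZeta 2 (i + s + 1) (4 : ℚ_[2])⁻¹ :=
  volkenbornIntegral_eq (tendsto_volkenbornSum_DBs s n)

/-- The Riemann sums of `B_n^{(s)}(t+¼)` tend to `T_n`. [cite: Lai2025TwoAdicZeta, Definition 3.2] -/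
theorem tendsto_volkenbornSum_DBs_Ts (s n : ℕ) : Tendsto (volkenbornSum 2 (DBs s n)) atTop (𝓝 (Ts s n)) := by
  rw [Ts_eq]; exact tendsto_volkenbornSum_DBs s n

/-! ## §5. Lemma 4.5 (`d_n^{s+2−i}σ_{n,i} ∈ ℤ`) and Lemma 4.6 (`d_n^{2s+3}σ_{n,0} ∈ ℤ`) -/

/-- **Lemma 4.5 (sigma_i_ari), general `s`:** `d_n^{s+2−i}·σ_{n,i} ∈ ℤ` (from Lemma 4.2 (ari_b)).
[cite: Lai2025TwoAdicZeta, Lemma 4.5 (sigma_i_ari)] -/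
theorem exists_int_lcm_pow_mul_sigmaI (s n i : ℕ) :
    ∃ z : ℤ, (Nat.lcmUpto n : ℚ) ^ (s + 2 - i) * sigmaI s n i = z := by
  have h : ∀ k ∈ range (n + 1), ∃ z : ℤ, (Nat.lcmUpto n : ℚ) ^ (s + 2 - i) * coeffBs s n i k = z :=
    fun k hk => exists_int_lcm_pow_mul_coeffBs s n (by have := mem_range.1 hk; omega) i
  choose! z hz using h
  have hsum : (Nat.lcmUpto n : ℚ) ^ (s + 2 - i) * ∑ k ∈ range (n + 1), coeffBs s n i k =
      ∑ k ∈ range (n + 1), (z k : ℚ) := by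
    rw [mul_sum]; exact sum_congr rfl hz
  refine ⟨(-1) ^ s * (i.ascFactorial (s + 1) : ℤ) * 4 ^ (i + s) * ∑ k ∈ range (n + 1), z k, ?_⟩
  calc (Nat.lcmUpto n : ℚ) ^ (s + 2 - i) * sigmaI s n i = (-1) ^ s * (i.ascFactorial (s + 1) : ℚ) * 4 ^ (i + s) *
        ((Nat.lcmUpto n : ℚ) ^ (s + 2 - i) * ∑ k ∈ range (n + 1), coeffBs s n i k) := by rw [sigmaI]; ring
    _ = _ := by rw [hsum]; push_cast; ring

/-- In particular `d_n^{2s+3}σ_{n,i} ∈ ℤ`. [cite: Lai2025TwoAdicZeta, §7 (proof of Thm 1.3: "d_n^{2s+3}T_n is a linear combination … with integer coefficients")] -/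
theorem exists_int_lcm_pow_mul_sigmaI' (s n i : ℕ) :
    ∃ z : ℤ, (Nat.lcmUpto n : ℚ) ^ (2 * s + 3) * sigmaI s n i = z := by
  obtain ⟨z, hz⟩ := exists_int_lcm_pow_mul_sigmaI s n i
  refine ⟨(Nat.lcmUpto n : ℤ) ^ (2 * s + 3 - (s + 2 - i)) * z, ?_⟩
  push_cast
  rw [← hz, ← mul_assoc, ← pow_add]
  congr 2
  omega

/-! ### The root relation: `B_n^{(s+1)}(¼ − m) = 0` for `1 ≤ m ≤ n`, read through (def_b) -/

/-- **The root relation** (`1 ≤ m ≤ n`): `Σ_{k=0}^{n} Σ_{i=1}^{s+2} (i)_{s+1}·b_{n,i,k}·(k − m + ¼)^{−(i+s+1)} = 0`, i.e.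
`B_n^{(s+1)}(¼ − m) = 0` read through (def_b). [cite: Lai2025TwoAdicZeta, Lemma 4.6 (proof: "t = −k₀+ℓ₀+¼ is a root of B_n^{(s+1)}")] -/
theorem sum_XtermS_root_eq_zero (s n : ℕ) {m : ℕ} (hm1 : 1 ≤ m) (hmn : m ≤ n) :
    ∑ k ∈ range (n + 1), XtermS s n k ((1 : ℚ) / 4 - m + k) = 0 := by
  have hx : ∀ j ∈ range (n + 1), (1 : ℚ) / 4 - m + j ≠ 0 := by
    intro j _ h
    have h4 : (4 * (j : ℤ) - 4 * m + 1 : ℤ) = 0 := by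
      have : (4 * (j : ℚ) - 4 * m + 1) = 0 := by linarith
      exact_mod_cast this
    omega
  have h := iteratedDeriv_Bs s n (s + 1) hx
  rw [iteratedDeriv_Bs_quarter_eq_zero s n hm1 hmn] at h
  have h1 : ((-1 : ℚ) ^ (s + 1)) ≠ 0 := pow_ne_zero _ (by norm_num)
  have h2 := (mul_eq_zero.1 h.symm).resolve_left h1
  rw [← h2]
  refine sum_congr rfl fun k _ => ?_
  rw [XtermS]
  refine sum_congr rfl fun i _ => ?_
  rw [show i + (s + 1) = i + s + 1 by ring]

/-! ### Lemma 4.6, prime by prime -/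

/-- `q`-integrality of one term: if `v_q(N) ≤ v_q(d_n)` (`‖d_n/N‖_q ≤ 1`) then `‖d_n^{2s+3} · X_{n,k}(N/4)‖_q ≤ 1` (`k ≤ n`),
since `d_n^{2s+3}(i)_{s+1}b_{n,i,k}(N/4)^{−(i+s+1)} = (i)_{s+1}4^{i+s+1}·(d_n^{s+2−i}b_{n,i,k})·(d_n/N)^{i+s+1}` with
`d_n^{s+2−i}b_{n,i,k} ∈ ℤ` (Lemma 4.2). [cite: Lai2025TwoAdicZeta, Lemma 4.6 (proof: "we have by (ari_b) … It follows that v_q(ℓ₀+¼) > v_q(d_n)")] -/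
theorem padicNorm_lcm_pow_mul_XtermS_le (q : ℕ) [Fact q.Prime] (s n : ℕ) {k : ℕ} (hk : k ≤ n) {N : ℤ}
    (hN : N ≠ 0) (hle : padicNorm q ((Nat.lcmUpto n : ℚ) / N) ≤ 1) :
    padicNorm q ((Nat.lcmUpto n : ℚ) ^ (2 * s + 3) * XtermS s n k ((N : ℚ) / 4)) ≤ 1 := by
  have hN' : (N : ℚ) ≠ 0 := by exact_mod_cast hN
  rw [XtermS, mul_sum]
  refine padicNorm.sum_le' (fun i hi => ?_) zero_le_one
  have hi' := mem_Icc.1 hi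
  obtain ⟨z, hz⟩ := exists_int_lcm_pow_mul_coeffBs s n hk i
  set d : ℚ := (Nat.lcmUpto n : ℚ) with hd
  -- rewrite the term as `(i)_{s+1} 4^{i+s+1} · z · (d/N)^{i+s+1}`
  have e : d ^ (2 * s + 3) = d ^ (s + 2 - i) * d ^ (i + s + 1) := by
    rw [← pow_add]; congr 1; omega
  have hexp : d ^ (2 * s + 3) * ((i.ascFactorial (s + 1) : ℚ) * coeffBs s n i k * ((((N : ℚ) / 4)) ^ (i + s + 1))⁻¹) =
      ((i.ascFactorial (s + 1) * 4 ^ (i + s + 1) : ℕ) : ℚ) * (z : ℚ) * (d / N) ^ (i + s + 1) := by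
    rw [e, show d ^ (s + 2 - i) * d ^ (i + s + 1) * ((i.ascFactorial (s + 1) : ℚ) * coeffBs s n i k *
        ((((N : ℚ) / 4)) ^ (i + s + 1))⁻¹) = (i.ascFactorial (s + 1) : ℚ) * (d ^ (s + 2 - i) * coeffBs s n i k) *
        (d ^ (i + s + 1) * ((((N : ℚ) / 4)) ^ (i + s + 1))⁻¹) by ring, hz, ← inv_pow, ← mul_pow,
      show d * (((N : ℚ) / 4))⁻¹ = 4 * (d / N) by field_simp, mul_pow]
    push_cast
    ring
  rw [hexp, padicNorm.mul, padicNorm.mul, IsAbsoluteValue.abv_pow (padicNorm q)]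
  exact mul_le_one₀ (mul_le_one₀ (padicNorm.of_nat _) (padicNorm.nonneg _) (padicNorm.of_int _))
    (pow_nonneg (padicNorm.nonneg _) _) (pow_le_one₀ (padicNorm.nonneg _) hle)

/-- **Each term of `σ_{n,0}` is `d_n^{2s+3}`-integral**: `d_n^{2s+3} · X_{n,k}(ℓ+¼) ∈ ℤ` for `0 ≤ ℓ < k ≤ n` — at a prime
`q` with `v_q(4ℓ+1) ≤ v_q(d_n)` directly, and otherwise through the root relation at `m = k − ℓ`, all of whose other
terms are `q`-integral (no two bad shifts, tree `not_dvd_both`). [cite: Lai2025TwoAdicZeta, Lemma 4.6 (proof)] -/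
theorem exists_int_lcm_pow_mul_XtermS (s n : ℕ) {k ℓ : ℕ} (hk : k ≤ n) (hℓ : ℓ < k) :
    ∃ z : ℤ, (z : ℚ) = (Nat.lcmUpto n : ℚ) ^ (2 * s + 3) * XtermS s n k ((ℓ : ℚ) + 1 / 4) := by
  refine Literature.Algebra.Module.Rat.exists_int_eq_of_forall_padicNorm_le_one _ fun q hq => ?_
  haveI : Fact q.Prime := ⟨hq⟩
  have hN : (4 * (ℓ : ℤ) + 1 : ℤ) ≠ 0 := by omega
  have hy : ((ℓ : ℚ) + 1 / 4) = (((4 * (ℓ : ℤ) + 1 : ℤ)) : ℚ) / 4 := by push_cast; ring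
  by_cases hgood : padicNorm q ((Nat.lcmUpto n : ℚ) / ((4 * (ℓ : ℤ) + 1 : ℤ) : ℚ)) ≤ 1
  · rw [hy]
    exact padicNorm_lcm_pow_mul_XtermS_le q s n hk hN hgood
  · -- the bad case: use the root relation at `m = k − ℓ`
    have hbad := pow_log_succ_dvd_of_one_lt_padicNorm q n hN (not_le.1 hgood)
    have hm1 : 1 ≤ k - ℓ := by omega
    have hmn : k - ℓ ≤ n := by omega
    have hroot := sum_XtermS_root_eq_zero s n hm1 hmn
    rw [← add_sum_erase _ _ (mem_range.2 (by omega : k < n + 1))] at hroot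
    have hkk : (1 : ℚ) / 4 - ((k - ℓ : ℕ) : ℚ) + k = (ℓ : ℚ) + 1 / 4 := by
      rw [Nat.cast_sub hℓ.le]; ring
    rw [hkk] at hroot
    have hX : (Nat.lcmUpto n : ℚ) ^ (2 * s + 3) * XtermS s n k ((ℓ : ℚ) + 1 / 4) =
        -∑ k' ∈ (range (n + 1)).erase k,
          (Nat.lcmUpto n : ℚ) ^ (2 * s + 3) * XtermS s n k' ((1 : ℚ) / 4 - ((k - ℓ : ℕ) : ℚ) + k') := by
      rw [← mul_sum, ← mul_neg]
      congr 1
      linarith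
    rw [hX, padicNorm.neg]
    refine padicNorm.sum_le' (fun k' hk' => ?_) zero_le_one
    have hk'k : k' ≠ k := (mem_erase.1 hk').1
    have hk'n : k' ≤ n := by have := mem_range.1 (mem_of_mem_erase hk'); omega
    have hN' : (4 * ((k' : ℤ) - k + ℓ) + 1 : ℤ) ≠ 0 := by omega
    have hy' : (1 : ℚ) / 4 - ((k - ℓ : ℕ) : ℚ) + k' = (((4 * ((k' : ℤ) - k + ℓ) + 1 : ℤ)) : ℚ) / 4 := by
      rw [Nat.cast_sub hℓ.le]; push_cast; ring
    rw [hy']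
    refine padicNorm_lcm_pow_mul_XtermS_le q s n hk'n hN' ?_
    by_contra hgt
    exact not_dvd_both q n hk hk'n hk'k ℓ hbad (pow_log_succ_dvd_of_one_lt_padicNorm q n hN' (not_le.1 hgt))

/-- **Lemma 4.6 (sigma_0_ari), general `s`: `d_n^{2s+3} · σ_{n,0} ∈ ℤ`.** [cite: Lai2025TwoAdicZeta, Lemma 4.6 (sigma_0_ari)] -/
theorem exists_int_lcm_pow_mul_sigmaZero (s n : ℕ) :
    ∃ z : ℤ, (Nat.lcmUpto n : ℚ) ^ (2 * s + 3) * sigmaZero s n = z := by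
  have h : ∀ k ∈ range (n + 1), ∀ ℓ ∈ range k, ∃ z : ℤ,
      (z : ℚ) = (Nat.lcmUpto n : ℚ) ^ (2 * s + 3) * XtermS s n k ((ℓ : ℚ) + 1 / 4) := fun k hk ℓ hℓ =>
    exists_int_lcm_pow_mul_XtermS s n (by have := mem_range.1 hk; omega) (mem_range.1 hℓ)
  choose! z hz using h
  refine ⟨(-1) ^ (s + 1) * ∑ k ∈ range (n + 1), ∑ ℓ ∈ range k, z k ℓ, ?_⟩
  rw [sigmaZero, mul_left_comm, mul_sum]
  push_cast
  congr 1
  refine sum_congr rfl fun k hk => ?_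
  rw [mul_sum]
  exact sum_congr rfl fun ℓ hℓ => (hz k hk ℓ hℓ).symm

/-! ## §6. Lemma 5.2 (general `s`): polynomial·`2^{(3s+6)n}` bounds for `σ_{n,i}`, `σ_{n,0}` -/

/-- The constant `K(s) := (s+3)·(2s+3)^{s+1}·4^{2s+3}·(5(s+2))^{s+1}` of the explicit Lemma 5.2 (depends on `s` only).
[cite: Lai2025TwoAdicZeta, Lemma 5.2 (sigma_est: the o(1) made explicit)] -/
def Ksig (s : ℕ) : ℚ := ((s : ℚ) + 3) * (2 * s + 3) ^ (s + 1) * 4 ^ (2 * s + 3) * (5 * ((s : ℚ) + 2)) ^ (s + 1)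

/-- `K(s) ≥ 1`. [cite: Lai2025TwoAdicZeta, Lemma 5.2] -/
theorem one_le_Ksig (s : ℕ) : 1 ≤ Ksig s := by
  unfold Ksig
  have h1 : (1 : ℚ) ≤ (s : ℚ) + 3 := by have : (0 : ℚ) ≤ s := Nat.cast_nonneg s; linarith
  have h2 : (1 : ℚ) ≤ (2 * s + 3) ^ (s + 1) := one_le_pow₀ (by have : (0 : ℚ) ≤ s := Nat.cast_nonneg s; linarith)
  have h3 : (1 : ℚ) ≤ 4 ^ (2 * s + 3) := one_le_pow₀ (by norm_num)
  have h4 : (1 : ℚ) ≤ (5 * ((s : ℚ) + 2)) ^ (s + 1) :=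
    one_le_pow₀ (by have : (0 : ℚ) ≤ s := Nat.cast_nonneg s; linarith)
  calc (1 : ℚ) = 1 * 1 * 1 * 1 := by ring
    _ ≤ _ := by gcongr

/-- One coefficient term: `(i)_{s+1}·|b_{n,i,k}|·4^{e} ≤ (2s+3)^{s+1}·4^{2s+3}·2^{(3s+6)n}·(5(s+2)(n+1))^{s+1}` for
`1 ≤ i ≤ s+2`, `e ≤ 2s+3`, `k ≤ n`. [cite: Lai2025TwoAdicZeta, Lemma 5.2 (proof)] -/
theorem coeff_term_le (s n : ℕ) {k : ℕ} (hk : k ≤ n) {i : ℕ} (hi : i ∈ Icc 1 (s + 2)) {e : ℕ} (he : e ≤ 2 * s + 3) :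
    (i.ascFactorial (s + 1) : ℚ) * |coeffBs s n i k| * 4 ^ e ≤
      (2 * s + 3) ^ (s + 1) * 4 ^ (2 * s + 3) * ((2 : ℚ) ^ ((3 * s + 6) * n) * (5 * ((s : ℚ) + 2) * (n + 1)) ^ (s + 1)) := by
  have hi' := mem_Icc.1 hi
  have hs0 : (0 : ℚ) ≤ s := Nat.cast_nonneg s
  have hn0 : (0 : ℚ) ≤ n := Nat.cast_nonneg n
  -- `(i)_{s+1} ≤ (i+s+1)^{s+1} ≤ (2s+3)^{s+1}`
  have hasc : (i.ascFactorial (s + 1) : ℚ) ≤ (2 * s + 3) ^ (s + 1) := by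
    obtain ⟨i', rfl⟩ : ∃ i', i = i' + 1 := ⟨i - 1, by omega⟩
    have h1 : (i' + 1).ascFactorial (s + 1) ≤ (i' + (s + 1)) ^ (s + 1) := Nat.ascFactorial_le_pow_add i' (s + 1)
    have h2 : (i' + (s + 1)) ^ (s + 1) ≤ (2 * s + 3) ^ (s + 1) := Nat.pow_le_pow_left (by omega) _
    exact_mod_cast h1.trans h2
  have h4 : (4 : ℚ) ^ e ≤ 4 ^ (2 * s + 3) := pow_le_pow_right₀ (by norm_num) he
  -- `|b| ≤ 2^{(3s+6)n}(5(s+2)n)^{s+2−i} ≤ 2^{(3s+6)n}(5(s+2)(n+1))^{s+1}`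
  have hb : |coeffBs s n i k| ≤ (2 : ℚ) ^ ((3 * s + 6) * n) * (5 * ((s : ℚ) + 2) * (n + 1)) ^ (s + 1) := by
    refine (abs_coeffBs_le s n hk i).trans (mul_le_mul_of_nonneg_left ?_ (by positivity))
    have hW : (1 : ℚ) ≤ 5 * ((s : ℚ) + 2) * (n + 1) := by nlinarith
    calc (5 * ((s + 2 : ℕ) : ℚ) * n) ^ (s + 2 - i) ≤ (5 * ((s : ℚ) + 2) * (n + 1)) ^ (s + 2 - i) := by
          apply pow_le_pow_left₀ (by positivity)
          push_cast; nlinarith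
      _ ≤ (5 * ((s : ℚ) + 2) * (n + 1)) ^ (s + 1) := pow_le_pow_right₀ hW (by omega)
  calc (i.ascFactorial (s + 1) : ℚ) * |coeffBs s n i k| * 4 ^ e
      ≤ (2 * s + 3) ^ (s + 1) * ((2 : ℚ) ^ ((3 * s + 6) * n) * (5 * ((s : ℚ) + 2) * (n + 1)) ^ (s + 1)) *
          4 ^ (2 * s + 3) := by
        exact mul_le_mul (mul_le_mul hasc hb (abs_nonneg _) (by positivity)) h4 (by positivity) (by positivity)
    _ = _ := by ring

/-- **`|σ_{n,i}| ≤ K(s)·(n+1)^{s+4}·2^{(3s+6)n}`** (`1 ≤ i ≤ s+2`). [cite: Lai2025TwoAdicZeta, Lemma 5.2 (sigma_est)] -/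
theorem abs_sigmaI_le (s n : ℕ) {i : ℕ} (hi : i ∈ Icc 1 (s + 2)) :
    |sigmaI s n i| ≤ Ksig s * ((n : ℚ) + 1) ^ (s + 4) * 2 ^ ((3 * s + 6) * n) := by
  have hi' := mem_Icc.1 hi
  have hs0 : (0 : ℚ) ≤ s := Nat.cast_nonneg s
  have hn0 : (0 : ℚ) ≤ n := Nat.cast_nonneg n
  rw [sigmaI, abs_mul, abs_mul, abs_mul, abs_pow, abs_neg, abs_one, one_pow, one_mul, Nat.abs_cast,
    abs_pow, show |(4 : ℚ)| = 4 by norm_num]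
  have hsum : |∑ k ∈ range (n + 1), coeffBs s n i k| ≤ ∑ k ∈ range (n + 1), |coeffBs s n i k| :=
    abs_sum_le_sum_abs _ _
  have hterms : ∀ k ∈ range (n + 1), (i.ascFactorial (s + 1) : ℚ) * |coeffBs s n i k| * 4 ^ (i + s) ≤
      (2 * s + 3) ^ (s + 1) * 4 ^ (2 * s + 3) * ((2 : ℚ) ^ ((3 * s + 6) * n) * (5 * ((s : ℚ) + 2) * (n + 1)) ^ (s + 1)) :=
    fun k hk => coeff_term_le s n (by have := mem_range.1 hk; omega) hi (by omega)
  calc (i.ascFactorial (s + 1) : ℚ) * 4 ^ (i + s) * |∑ k ∈ range (n + 1), coeffBs s n i k|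
      ≤ (i.ascFactorial (s + 1) : ℚ) * 4 ^ (i + s) * ∑ k ∈ range (n + 1), |coeffBs s n i k| :=
        mul_le_mul_of_nonneg_left hsum (by positivity)
    _ = ∑ k ∈ range (n + 1), (i.ascFactorial (s + 1) : ℚ) * |coeffBs s n i k| * 4 ^ (i + s) := by
        rw [mul_sum]; exact sum_congr rfl fun k _ => by ring
    _ ≤ ∑ _k ∈ range (n + 1), (2 * s + 3) ^ (s + 1) * 4 ^ (2 * s + 3) *
          ((2 : ℚ) ^ ((3 * s + 6) * n) * (5 * ((s : ℚ) + 2) * (n + 1)) ^ (s + 1)) := sum_le_sum hterms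
    _ = ((n : ℚ) + 1) * ((2 * s + 3) ^ (s + 1) * 4 ^ (2 * s + 3) *
          ((2 : ℚ) ^ ((3 * s + 6) * n) * (5 * ((s : ℚ) + 2) * (n + 1)) ^ (s + 1))) := by
        rw [sum_const, card_range, nsmul_eq_mul]; push_cast; ring
    _ ≤ Ksig s * ((n : ℚ) + 1) ^ (s + 4) * 2 ^ ((3 * s + 6) * n) := by
        rw [Ksig, mul_pow]
        have h1 : (1 : ℚ) ≤ (s : ℚ) + 3 := by linarith
        have hn1 : (1 : ℚ) ≤ (n : ℚ) + 1 := by linarith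
        have hp : ((n : ℚ) + 1) * ((n : ℚ) + 1) ^ (s + 1) ≤ ((n : ℚ) + 1) ^ (s + 4) := by
          calc ((n : ℚ) + 1) * ((n : ℚ) + 1) ^ (s + 1) = ((n : ℚ) + 1) ^ (s + 2) := by ring
            _ ≤ ((n : ℚ) + 1) ^ (s + 4) := pow_le_pow_right₀ hn1 (by omega)
        calc ((n : ℚ) + 1) * ((2 * s + 3) ^ (s + 1) * 4 ^ (2 * s + 3) *
              ((2 : ℚ) ^ ((3 * s + 6) * n) * ((5 * ((s : ℚ) + 2)) ^ (s + 1) * ((n : ℚ) + 1) ^ (s + 1))))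
            = 1 * (2 * s + 3) ^ (s + 1) * 4 ^ (2 * s + 3) * (5 * ((s : ℚ) + 2)) ^ (s + 1) *
                (((n : ℚ) + 1) * ((n : ℚ) + 1) ^ (s + 1)) * (2 : ℚ) ^ ((3 * s + 6) * n) := by ring
          _ ≤ ((s : ℚ) + 3) * (2 * s + 3) ^ (s + 1) * 4 ^ (2 * s + 3) * (5 * ((s : ℚ) + 2)) ^ (s + 1) *
                ((n : ℚ) + 1) ^ (s + 4) * (2 : ℚ) ^ ((3 * s + 6) * n) := by gcongr

/-- `|X_{n,k}(ℓ + ¼)| ≤ (s+2)·(2s+3)^{s+1}4^{2s+3}·2^{(3s+6)n}(5(s+2)(n+1))^{s+1}` (`(ℓ+¼)^{−e} ≤ 4^e`).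
[cite: Lai2025TwoAdicZeta, Lemma 5.2 (proof: the bound for σ_{n,0})] -/
theorem abs_XtermS_le (s n : ℕ) {k : ℕ} (hk : k ≤ n) (ℓ : ℕ) :
    |XtermS s n k ((ℓ : ℚ) + 1 / 4)| ≤ ((s : ℚ) + 2) * ((2 * s + 3) ^ (s + 1) * 4 ^ (2 * s + 3) *
      ((2 : ℚ) ^ ((3 * s + 6) * n) * (5 * ((s : ℚ) + 2) * (n + 1)) ^ (s + 1))) := by
  have hy : (1 / 4 : ℚ) ≤ (ℓ : ℚ) + 1 / 4 := by have : (0 : ℚ) ≤ ℓ := Nat.cast_nonneg ℓ; linarith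
  have hy0 : (0 : ℚ) < (ℓ : ℚ) + 1 / 4 := by positivity
  have hinv : ∀ e : ℕ, (((ℓ : ℚ) + 1 / 4) ^ e)⁻¹ ≤ 4 ^ e := by
    intro e
    rw [← inv_pow]
    refine pow_le_pow_left₀ (by positivity) ?_ e
    calc (((ℓ : ℚ) + 1 / 4))⁻¹ ≤ (1 / 4 : ℚ)⁻¹ := inv_anti₀ (by norm_num) hy
      _ = 4 := by norm_num
  rw [XtermS]
  refine (abs_sum_le_sum_abs _ _).trans ?_
  have hterm : ∀ i ∈ Icc 1 (s + 2), |(i.ascFactorial (s + 1) : ℚ) * coeffBs s n i k * (((ℓ : ℚ) + 1 / 4) ^ (i + s + 1))⁻¹|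
      ≤ (2 * s + 3) ^ (s + 1) * 4 ^ (2 * s + 3) *
        ((2 : ℚ) ^ ((3 * s + 6) * n) * (5 * ((s : ℚ) + 2) * (n + 1)) ^ (s + 1)) := by
    intro i hi
    have hi' := mem_Icc.1 hi
    rw [abs_mul, abs_mul, Nat.abs_cast, abs_inv, abs_pow, abs_of_pos hy0]
    calc (i.ascFactorial (s + 1) : ℚ) * |coeffBs s n i k| * (((ℓ : ℚ) + 1 / 4) ^ (i + s + 1))⁻¹
        ≤ (i.ascFactorial (s + 1) : ℚ) * |coeffBs s n i k| * 4 ^ (i + s + 1) :=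
          mul_le_mul_of_nonneg_left (hinv _) (by positivity)
      _ ≤ _ := coeff_term_le s n hk hi (by omega)
  refine (sum_le_sum hterm).trans ?_
  rw [sum_const, Nat.card_Icc, show s + 2 + 1 - 1 = s + 2 by omega, nsmul_eq_mul]
  push_cast
  exact le_rfl

/-- **`|σ_{n,0}| ≤ K(s)·(n+1)^{s+4}·2^{(3s+6)n}`** — Lemma 5.2's `max_i|σ_{n,i}| ≤ 2^{(3s+6+o(1))n}` at `i = 0`, with an explicit
polynomial factor. [cite: Lai2025TwoAdicZeta, Lemma 5.2 (sigma_est)] -/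
theorem abs_sigmaZero_le (s n : ℕ) :
    |sigmaZero s n| ≤ Ksig s * ((n : ℚ) + 1) ^ (s + 4) * 2 ^ ((3 * s + 6) * n) := by
  have hs0 : (0 : ℚ) ≤ s := Nat.cast_nonneg s
  have hn0 : (0 : ℚ) ≤ n := Nat.cast_nonneg n
  set M : ℚ := ((s : ℚ) + 2) * ((2 * s + 3) ^ (s + 1) * 4 ^ (2 * s + 3) *
      ((2 : ℚ) ^ ((3 * s + 6) * n) * (5 * ((s : ℚ) + 2) * (n + 1)) ^ (s + 1))) with hM
  have hM0 : 0 ≤ M := by positivity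
  rw [sigmaZero, abs_mul, abs_pow, abs_neg, abs_one, one_pow, one_mul]
  refine (abs_sum_le_sum_abs _ _).trans ?_
  have h : ∀ k ∈ range (n + 1), |∑ ℓ ∈ range k, XtermS s n k ((ℓ : ℚ) + 1 / 4)| ≤ ((n : ℚ) + 1) * M := by
    intro k hk
    have hkn : k ≤ n := by have := mem_range.1 hk; omega
    refine (abs_sum_le_sum_abs _ _).trans ?_
    refine (sum_le_sum fun ℓ _ => abs_XtermS_le s n hkn ℓ).trans ?_
    rw [sum_const, card_range, nsmul_eq_mul]
    refine mul_le_mul_of_nonneg_right ?_ hM0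
    have : (k : ℚ) ≤ n := by exact_mod_cast hkn
    linarith
  refine (sum_le_sum h).trans ?_
  rw [sum_const, card_range, nsmul_eq_mul]
  push_cast
  -- `(n+1)² · M ≤ K(s) (n+1)^{s+4} 2^{(3s+6)n}`
  have hn1 : (1 : ℚ) ≤ (n : ℚ) + 1 := by linarith
  have hp : ((n : ℚ) + 1) * ((n : ℚ) + 1) * ((n : ℚ) + 1) ^ (s + 1) ≤ ((n : ℚ) + 1) ^ (s + 4) := by
    calc ((n : ℚ) + 1) * ((n : ℚ) + 1) * ((n : ℚ) + 1) ^ (s + 1) = ((n : ℚ) + 1) ^ (s + 3) := by ring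
      _ ≤ ((n : ℚ) + 1) ^ (s + 4) := pow_le_pow_right₀ hn1 (by omega)
  have hs3 : (s : ℚ) + 2 ≤ (s : ℚ) + 3 := by linarith
  calc ((n : ℚ) + 1) * (((n : ℚ) + 1) * M)
      = ((s : ℚ) + 2) * (2 * s + 3) ^ (s + 1) * 4 ^ (2 * s + 3) * (5 * ((s : ℚ) + 2)) ^ (s + 1) *
          (((n : ℚ) + 1) * ((n : ℚ) + 1) * ((n : ℚ) + 1) ^ (s + 1)) * (2 : ℚ) ^ ((3 * s + 6) * n) := by
        rw [hM, mul_pow]; ring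
    _ ≤ ((s : ℚ) + 3) * (2 * s + 3) ^ (s + 1) * 4 ^ (2 * s + 3) * (5 * ((s : ℚ) + 2)) ^ (s + 1) *
          ((n : ℚ) + 1) ^ (s + 4) * (2 : ℚ) ^ ((3 * s + 6) * n) := by gcongr
    _ = Ksig s * ((n : ℚ) + 1) ^ (s + 4) * 2 ^ ((3 * s + 6) * n) := by rw [Ksig]

end GeneralLinearForms

end Literature.NumberTheory.Irrationality.Lai2025TwoAdic
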